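import Summits.BirchSwinnertonDyer.Rank1Residual.P2.CongruentNumberSilentEvenFiveRankDescent
import Summits.BirchSwinnertonDyer.Rank1Residual.P2.CongruentNumberEvenFiveFamilyDescent
import Summits.BirchSwinnertonDyer.Rank1Residual.P2.CongruentNumberEvenFiveSelmerExact
import Literature.NumberTheory.EllipticCurves.Tian2014.CMPointSystemGenusBridgeThreeModEight
import Literature.NumberTheory.EllipticCurves.CongruentNumberEvenFiveSelmerBoundThreeModEight
import HarnessLib

/-!
# Cell `bsd-monsky`, route A on ALL of Monsky's case (13): `ord_{s=1} L(E_{2pq}, s) = 1 ∧ BSD(E_{2pq}, 2)` for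
# `p ≡ 5 (8)`, `q ≡ 3 (8)`, EITHER sign of `(p/q)`, from Tian's CM-point system sentences ALONE — no GZK, no TYZ
# genus theorem, no `2`-Selmer display (the route-A twin of `…ThreeModEightDescent.lean`'s route-B door)

HONEST FRAMING (cell `bsd-monsky`, run/shared/lean/pub/bsd-monsky/; README §1): ONE theorem on ONE explicit infinite
family of quadratic twists of the congruent number curve at the prime `2`; nothing is booked by this file; the
conclusions are CONDITIONAL on the system sentences taken as a binder. WHAT IT DOES. Monsky's Theorem 5.5 transplanted
onto Tian's CM points holds on ALL of case (13) `N = 2p₃p₅` (`Tian2014/CMPointSystemGenusBridgeThreeModEight.lean`: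
`Printed ∧ GenusTheoryDisplays ⟹ MinusY` for `p ≡ 5 (8)`, `q ≡ 3 (8)`, either symbol). With the landed per-pair glue of
route A — the kernel rank bound `rk E_{2pq}(ℚ) ≤ 1` + the system's own point `y ∉ 2E + tor` ⟹ `rk = 1`
(`mordellWeilRank_eq_one_of_not_two_smul_add_torsion_two_mul_five_mul`), a generator, M-y ∧ GZ ⟹ `𝓛(2pq)` odd
(`exists_odd_scriptL_of_minusY_of_grossZagier`), the odd-index datum (`oddIndexHeegnerDatum_of_odd_scriptL`),
`ord = 1` and `L′ = 2²·𝓛²·Ω·Reg` (`analyticRank_congruentNumberCurve_eq_one_of_isScriptL`,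
`leadingLCoeff_congruentNumberCurve_eq_of_isScriptL`), `Ш[2^∞] = 0` from the kernel `2`-Selmer bound
(`card_selmerGroup_two_le_eight_congruentNumberCurve_two_mul_five_three_mod_eight`, prover-B g13) and the door D-CN-5′
(`bsdp_two_congruentNumberCurve_iff_of_rank_one_of_sha_two_eq_bot`) — every pair of the family `{q ≡ 3 (8)}` gets
rank one, `Ш[2^∞] = 0`, `2pq` congruent, the odd-index datum, `ord_{s=1} L = 1` and `BSD(E_{2pq}, 2)` from ONE
hypothesis: «for each such pair there is a system `D : CMPointData (pq)` with `Printed`, `GrossZagierScriptL` and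
`GenusTheoryDisplays`» (the sentences of `tian2014_system_sMinus_genus`, indexed by case (13)). On the loud half
`(p/q) = +1` this is a SECOND PROOF of what route B (`…ThreeModEightDescent.lean`, `hΘ`) and TYZ's genus criterion give;
it uses neither the Gross–Zagier–Kolyvagin binder (`hGZK`) nor TYZ Thm. 1.2: route A's mechanism (odd index of the
Heegner point by Monsky's `2`-descent) covers Monsky's case (13) in full, as his Theorem 5.14 (13) states it. On the
silent quarter `(p/q) = −1` it coincides with the landed `…_of_genusSystem_descent` corner. Nothing asserted.
[cite: Monsky1990MockHeegner, Thm. 5.5 and Lemma 5.4 (p. 62), Thm. 5.14 (13) (p. 66), Lemma 3.3 (3) and Remark (p. 53)]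
[cite: Tian2014, Def. 2.7, Thm. 2.8 (p0011 L25–L44 = J132), Notations (J122–123)] [cite: TianYuanZhang2017, Thm. 3.3, §1 (1.1)]
[cite: Lagrange1975, §11 table p. 16-12] [cite: SilvermanAEC2009, Prop. X.1.4, Prop. X.4.9, Thm. X.4.2, Thm. VIII.6.7]
[cite: Miller2011LMS, Def. 1.1 (arXiv:1010.2431 p. 3)]
-/

noncomputable section

open scoped Classical

open WeierstrassCurve Literature.NumberTheory.EllipticCurves
  Literature.NumberTheory.EllipticCurves.Rank1Residual
  Literature.NumberTheory.EllipticCurves.Rank1Residual.Typed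
  Literature.NumberTheory.EllipticCurves.Monsky1990
  Literature.NumberTheory.EllipticCurves.TianYuanZhang2017

set_option autoImplicit false

namespace Summit.BirchSwinnertonDyer.Rank1Residual.P2

open Conjectures Literature.NumberTheory.EllipticCurves.Tian2014

/-! ## §1 Per pair: one system with `Printed`, the Gross–Zagier relation and M-y gives the datum, rank one, `Ш[2^∞] = 0` -/

section PerPair

variable {p q : ℕ}

/-- **One system with the Gross–Zagier relation and M-y gives the odd-index datum** for `p ≡ 5 (8)`, `q ≡ 3 (4)`
(either symbol): M-y's point and the kernel rank bound give rank one and a generator; M-y ∧ GZ give `𝓛(2pq)` odd.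
[cite: Monsky1990MockHeegner, Lemma 3.3 (3) and the Remark after it (p. 53)] [cite: TianYuanZhang2017, Thm. 3.3]
[cite: Lagrange1975, §11 table p. 16-12] -/
theorem oddIndexHeegnerDatum_of_grossZagier_of_minusY (hp : p.Prime) (hq : q.Prime) (hp5 : p % 8 = 5)
    (hq4 : q % 4 = 3) (D : CMPointData (p * q)) (hn : p * q ≠ 0) (hGZ : D.GrossZagierScriptL hn)
    (hMY : D.MinusY hn) : OddIndexHeegnerDatum (2 * (p * q)) := by
  obtain ⟨hN, -, -, -⟩ := isCor515Family_two_mul_five_mul hp hq hp5 hq4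
  haveI := isElliptic_congruentNumberCurve hN.ne_zero
  obtain ⟨-, -, y', -, hnot⟩ := id hMY
  have hrank : (congruentNumberCurve (2 * (p * q))).mordellWeilRank = 1 :=
    mordellWeilRank_eq_one_of_not_two_smul_add_torsion_two_mul_five_mul hp hq hp5 hq4 y' hnot
  obtain ⟨g, hg, -⟩ := exists_generatesFreePartRat_of_mordellWeilRank_eq_one hN.ne_zero hrank
  obtain ⟨L, hLodd, hL⟩ := D.exists_odd_scriptL_of_minusY_of_grossZagier _ hGZ hMY g hg
  exact oddIndexHeegnerDatum_of_odd_scriptL hN.ne_zero hrank hLodd hL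

/-- **The odd-index datum on ALL of case (13) from the system sentences**: `p ≡ 5 (8)`, `q ≡ 3 (8)`, either symbol.
[cite: Monsky1990MockHeegner, Thm. 5.5 (p. 62), Thm. 5.14 (13) (p. 66)] [cite: TianYuanZhang2017, Thm. 3.3] -/
theorem oddIndexHeegnerDatum_three_mod_eight_of_system
    (hSys : ∀ p q : ℕ, (hp : p.Prime) → (hq : q.Prime) → p % 8 = 5 → q % 8 = 3 →
      ∃ D : CMPointData (p * q), D.Printed ∧
        D.GrossZagierScriptL (Nat.mul_ne_zero hp.ne_zero hq.ne_zero) ∧ D.GenusTheoryDisplays)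
    (hp : p.Prime)
    (hq : q.Prime) (hp5 : p % 8 = 5) (hq3 : q % 8 = 3) : OddIndexHeegnerDatum (2 * (p * q)) := by
  obtain ⟨D, -, hGZ, hMY⟩ := exists_printed_grossZagier_minusY_of_threeModEightSystem hSys p q hp hq hp5 hq3
  exact oddIndexHeegnerDatum_of_grossZagier_of_minusY hp hq hp5 (by omega) D _ hGZ hMY

/-- **Rank one on ALL of case (13) from the system sentences.** [cite: Lagrange1975, §11 table p. 16-12]
[cite: Monsky1990MockHeegner, Thm. 5.5 (p. 62), Thm. 5.14 (13) (p. 66)] -/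
theorem mordellWeilRank_eq_one_three_mod_eight_of_system
    (hSys : ∀ p q : ℕ, (hp : p.Prime) → (hq : q.Prime) → p % 8 = 5 → q % 8 = 3 →
      ∃ D : CMPointData (p * q), D.Printed ∧
        D.GrossZagierScriptL (Nat.mul_ne_zero hp.ne_zero hq.ne_zero) ∧ D.GenusTheoryDisplays)
    (hp : p.Prime)
    (hq : q.Prime) (hp5 : p % 8 = 5) (hq3 : q % 8 = 3) :
    (congruentNumberCurve (2 * (p * q))).mordellWeilRank = 1 :=
  mordellWeilRank_eq_one_of_oddIndexHeegnerDatum_rankDescent hp hq hp5 (by omega)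
    (oddIndexHeegnerDatum_three_mod_eight_of_system hSys hp hq hp5 hq3)

/-- **`2pq` is a congruent number on ALL of case (13) from the system sentences** (Monsky 1990 Cor. 5.15 (2′)'s
congruent-number clause, `2p₃p₅`). [cite: Monsky1990MockHeegner, Cor. 5.15 (2′) (p. 66)] -/
theorem isCongruentNumber_three_mod_eight_of_system
    (hSys : ∀ p q : ℕ, (hp : p.Prime) → (hq : q.Prime) → p % 8 = 5 → q % 8 = 3 →
      ∃ D : CMPointData (p * q), D.Printed ∧
        D.GrossZagierScriptL (Nat.mul_ne_zero hp.ne_zero hq.ne_zero) ∧ D.GenusTheoryDisplays)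
    (hp : p.Prime)
    (hq : q.Prime) (hp5 : p % 8 = 5) (hq3 : q % 8 = 3) : IsCongruentNumber (2 * (p * q)) :=
  (Wiles2000.mordellWeilRank_ne_zero_iff_isCongruentNumber (mul_pos two_pos (mul_pos hp.pos hq.pos))).mp
    (by rw [mordellWeilRank_eq_one_three_mod_eight_of_system hSys hp hq hp5 hq3]; exact one_ne_zero)

/-- **`Ш(E_{2pq})[2^∞] = 0` on ALL of case (13) from the system sentences**: rank one and the kernel `2`-Selmer bound.
[cite: SilvermanAEC2009, Thm. X.4.2, Prop. X.4.9] -/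
theorem primaryComponent_sha_two_eq_bot_three_mod_eight_of_system
    (hSys : ∀ p q : ℕ, (hp : p.Prime) → (hq : q.Prime) → p % 8 = 5 → q % 8 = 3 →
      ∃ D : CMPointData (p * q), D.Printed ∧
        D.GrossZagierScriptL (Nat.mul_ne_zero hp.ne_zero hq.ne_zero) ∧ D.GenusTheoryDisplays)
    (hp : p.Prime) (hq : q.Prime) (hp5 : p % 8 = 5) (hq3 : q % 8 = 3) :
    haveI := isElliptic_congruentNumberCurve (n := 2 * (p * q))
      (Nat.mul_ne_zero two_ne_zero (Nat.mul_ne_zero hp.ne_zero hq.ne_zero))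
    AddCommGroup.primaryComponent (congruentNumberCurve (2 * (p * q))).sha 2 = ⊥ :=
  primaryComponent_sha_two_eq_bot_of_card_selmerGroup_le_eight
    (Nat.mul_ne_zero two_ne_zero (Nat.mul_ne_zero hp.ne_zero hq.ne_zero))
    (mordellWeilRank_eq_one_three_mod_eight_of_system hSys hp hq hp5 hq3)
    (card_selmerGroup_two_le_eight_congruentNumberCurve_two_mul_five_three_mod_eight hp hq hp5 hq3)

/-- **Clause (a) on ALL of case (13) from the system sentences**: `ord_{s=1} L(E_{2pq}, s) = 1`.
[cite: TianYuanZhang2017, Thm. 1.1, §1 (definition of 𝓛(n))] [cite: Monsky1990MockHeegner, Lemma 3.3 (3) (p. 53)] -/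
theorem analyticRank_eq_one_three_mod_eight_of_system
    (hSys : ∀ p q : ℕ, (hp : p.Prime) → (hq : q.Prime) → p % 8 = 5 → q % 8 = 3 →
      ∃ D : CMPointData (p * q), D.Printed ∧
        D.GrossZagierScriptL (Nat.mul_ne_zero hp.ne_zero hq.ne_zero) ∧ D.GenusTheoryDisplays)
    (hp : p.Prime)
    (hq : q.Prime) (hp5 : p % 8 = 5) (hq3 : q % 8 = 3) :
    (congruentNumberCurve (2 * (p * q))).analyticRank = 1 :=
  analyticRank_eq_one_of_oddIndexHeegnerDatum_rankDescent hp hq hp5 (by omega)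
    (oddIndexHeegnerDatum_three_mod_eight_of_system hSys hp hq hp5 hq3)

/-- **The `Ш_an`-unit datum on ALL of case (13) from the system sentences**: `L′(E_{2pq}, 1) = x·Ω·Reg` with
`x = 4𝓛(2pq)² ∈ ℚˣ`, `ord₂ x = 2` — the per-pair content of `CongruentSilentEvenFiveOrdTwo`, now on both symbols.
[cite: TianYuanZhang2017, §1 (definition of 𝓛(n) and (1.1), p0002 L46–L75)]
[cite: Monsky1990MockHeegner, Lemma 3.3 (3) and the Remark after it (p. 53)] -/
theorem exists_deriv_eq_three_mod_eight_of_system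
    (hSys : ∀ p q : ℕ, (hp : p.Prime) → (hq : q.Prime) → p % 8 = 5 → q % 8 = 3 →
      ∃ D : CMPointData (p * q), D.Printed ∧
        D.GrossZagierScriptL (Nat.mul_ne_zero hp.ne_zero hq.ne_zero) ∧ D.GenusTheoryDisplays)
    (hp : p.Prime)
    (hq : q.Prime) (hp5 : p % 8 = 5) (hq3 : q % 8 = 3) :
    ∃ x : ℚ, x ≠ 0 ∧
      deriv (congruentNumberCurve (2 * (p * q))).entireLFunction 1 =
        (x : ℂ) * ((congruentNumberCurve (2 * (p * q))).realPeriodRat : ℂ) *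
          ((congruentNumberCurve (2 * (p * q))).regulator : ℂ) ∧
      padicValRat 2 x = 2 := by
  have hq4 : q % 4 = 3 := by omega
  obtain ⟨hN, hp2, hq2, hne⟩ := isCor515Family_two_mul_five_mul hp hq hp5 hq4
  have hsq : Squarefree (2 * (p * q)) := hN.squarefree
  haveI := isElliptic_congruentNumberCurve hN.ne_zero
  have hmech := oddIndexHeegnerDatum_three_mod_eight_of_system hSys hp hq hp5 hq3
  have hrank : (congruentNumberCurve (2 * (p * q))).mordellWeilRank = 1 :=
    mordellWeilRank_eq_one_of_oddIndexHeegnerDatum_rankDescent hp hq hp5 hq4 hmech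
  obtain ⟨L, hLodd, hL⟩ := exists_odd_scriptL_of_oddIndexHeegnerDatum hN.ne_zero hrank hmech
  have hL0' : L ≠ 0 := fun h => by simp [h] at hLodd
  have hL0 : (L : ℚ) ≠ 0 := by exact_mod_cast hL0'
  have hr1 := analyticRank_congruentNumberCurve_eq_one_of_isScriptL hsq hN.mod_eight hL hL0'
  obtain ⟨he, -⟩ := twoExponent_tamagawa_two_mul_prime_mul hp hq hp2 hq2 hne
  refine ⟨(2 : ℚ) ^ twoExponent (2 * (p * q)) * (L : ℚ) ^ 2,
    mul_ne_zero (zpow_ne_zero _ two_ne_zero) (pow_ne_zero _ hL0), ?_, ?_⟩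
  · rw [← (leadingLCoeff_eq_deriv_of_analyticRank_eq_one hr1).1,
      leadingLCoeff_congruentNumberCurve_eq_of_isScriptL (Nat.pos_of_ne_zero hN.ne_zero) hr1 hL]
    push_cast
    ring
  · rw [padicValRat_two_zpow_mul_sq hLodd, he]

/-! ## §2 The door: `ord = 1 ∧ BSD₂` on ALL of case (13) from the system sentences ALONE -/

/-- **ROUTE A ON ALL OF MONSKY'S CASE (13): `ord_{s=1} L(E_{2pq}, s) = 1 ∧ BSD(E_{2pq}, 2)` for primes `p ≡ 5 (8)`,
`q ≡ 3 (8)`, EITHER sign of `(p/q)`, from Tian's CM-point system sentences ALONE** — no GZK binder, no TYZ genus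
theorem, no `2`-Selmer display: rank one from M-y + the kernel descent, `Ш[2^∞] = 0` from the kernel `2`-Selmer
bound, `𝓛(2pq)` odd from M-y + the Gross–Zagier relation, and the door D-CN-5′ with `∏c_ℓ = 2⁶`, `#tors = 4`.
The route-A twin of `analyticRank_eq_one_and_bsdp_two_three_mod_eight_of_thetaDisplay_descent` (route B). CONDITIONAL
on the system sentences; nothing asserted. [cite: Monsky1990MockHeegner, Thm. 5.5 (p. 62), Thm. 5.14 (13) (p. 66)]
[cite: Tian2014, Thm. 2.8 (J132), Notations (J122–123)] [cite: TianYuanZhang2017, Thm. 3.3, §1 (1.1)]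
[cite: SilvermanAEC2009, Prop. X.1.4, Prop. X.4.9, Thm. X.4.2] [cite: Miller2011LMS, Def. 1.1 (arXiv:1010.2431 p. 3)] -/
theorem analyticRank_eq_one_and_bsdp_two_three_mod_eight_of_system
    (hSys : ∀ p q : ℕ, (hp : p.Prime) → (hq : q.Prime) → p % 8 = 5 → q % 8 = 3 →
      ∃ D : CMPointData (p * q), D.Printed ∧
        D.GrossZagierScriptL (Nat.mul_ne_zero hp.ne_zero hq.ne_zero) ∧ D.GenusTheoryDisplays)
    (hp : p.Prime) (hq : q.Prime) (hp5 : p % 8 = 5) (hq3 : q % 8 = 3) :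
    (congruentNumberCurve (2 * (p * q))).analyticRank = 1 ∧ BSDp (congruentNumberCurve (2 * (p * q))) 2 := by
  have hq4 : q % 4 = 3 := by omega
  obtain ⟨hN, hp2, hq2, hne⟩ := isCor515Family_two_mul_five_mul hp hq hp5 hq4
  haveI := isElliptic_congruentNumberCurve hN.ne_zero
  haveI : Fact (Nat.Prime 2) := ⟨Nat.prime_two⟩
  obtain ⟨x, hx0, hx, hv⟩ := exists_deriv_eq_three_mod_eight_of_system hSys hp hq hp5 hq3
  obtain ⟨-, htam⟩ := twoExponent_tamagawa_two_mul_prime_mul hp hq hp2 hq2 hne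
  obtain ⟨hr1, hiff⟩ := bsdp_two_congruentNumberCurve_iff_of_rank_one_of_sha_two_eq_bot hN
    (mordellWeilRank_eq_one_three_mod_eight_of_system hSys hp hq hp5 hq3)
    (primaryComponent_sha_two_eq_bot_three_mod_eight_of_system hSys hp hq hp5 hq3)
    (torsionOrder_congruentNumberCurve hN.squarefree) hx0 hx
  refine ⟨hr1, hiff.mpr ?_⟩
  rw [hv, htam, padicValNat.prime_pow]
  norm_num

end PerPair

/-! ## §3 The family statement and the record of what is new -/

/-- **Case (13) in full from the system sentences**: for ALL primes `p ≡ 5 (8)`, `q ≡ 3 (8)` (either symbol),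
`ord_{s=1} L(E_{2pq}, s) = 1 ∧ BSD(E_{2pq}, 2)`. CONDITIONAL; nothing asserted.
[cite: Monsky1990MockHeegner, Thm. 5.14 (13) (p. 66)] [cite: Miller2011LMS, Def. 1.1 (arXiv:1010.2431 p. 3)] -/
theorem forall_analyticRank_eq_one_and_bsdp_two_three_mod_eight_of_system
    (hSys : ∀ p q : ℕ, (hp : p.Prime) → (hq : q.Prime) → p % 8 = 5 → q % 8 = 3 →
      ∃ D : CMPointData (p * q), D.Printed ∧
        D.GrossZagierScriptL (Nat.mul_ne_zero hp.ne_zero hq.ne_zero) ∧ D.GenusTheoryDisplays) :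
    ∀ p q : ℕ, p.Prime → q.Prime → p % 8 = 5 → q % 8 = 3 →
      (congruentNumberCurve (2 * (p * q))).analyticRank = 1 ∧ BSDp (congruentNumberCurve (2 * (p * q))) 2 :=
  fun _ _ hp hq hp5 hq3 => analyticRank_eq_one_and_bsdp_two_three_mod_eight_of_system hSys hp hq hp5 hq3

/-- **The loud quarter `(13)⁺ = {q ≡ 3 (8), (p/q) = +1}` from the system sentences alone** — what is NEW relative to
the landed enclosure (which had it from {TYZ data, GZK} or from route B's display): a second, GZK-free proof by
route A's mechanism. CONDITIONAL; nothing asserted. [cite: Monsky1990MockHeegner, Thm. 5.5 (p. 62), Thm. 5.14 (13) (p. 66)]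
[cite: Miller2011LMS, Def. 1.1 (arXiv:1010.2431 p. 3)] -/
theorem analyticRank_eq_one_and_bsdp_two_three_mod_eight_plus_of_system
    (hSys : ∀ p q : ℕ, (hp : p.Prime) → (hq : q.Prime) → p % 8 = 5 → q % 8 = 3 →
      ∃ D : CMPointData (p * q), D.Printed ∧
        D.GrossZagierScriptL (Nat.mul_ne_zero hp.ne_zero hq.ne_zero) ∧ D.GenusTheoryDisplays)
    {p q : ℕ} (hp : p.Prime) (hq : q.Prime) (hp5 : p % 8 = 5) (hq3 : q % 8 = 3) (_hj : jacobiSym p q = 1) :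
    (congruentNumberCurve (2 * (p * q))).analyticRank = 1 ∧ BSDp (congruentNumberCurve (2 * (p * q))) 2 :=
  analyticRank_eq_one_and_bsdp_two_three_mod_eight_of_system hSys hp hq hp5 hq3

/-- **Exact bookkeeping on case (13) from the system sentences**: rank one, `#Sel₂ = 8`, `Ш[2] = 0`, `Ш[2^∞] = 0`
and `2pq` congruent, in one statement (the unconditional `…EvenFiveSelmerExact` count joined to the conditional rank).
[cite: Monsky1990MockHeegner, Cor. 5.15 (2′) (p. 66), Remark (2) (p. 67)] [cite: SilvermanAEC2009, Thm. X.4.2] -/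
theorem rank_selmer_sha_three_mod_eight_of_system
    (hSys : ∀ p q : ℕ, (hp : p.Prime) → (hq : q.Prime) → p % 8 = 5 → q % 8 = 3 →
      ∃ D : CMPointData (p * q), D.Printed ∧
        D.GrossZagierScriptL (Nat.mul_ne_zero hp.ne_zero hq.ne_zero) ∧ D.GenusTheoryDisplays)
    {p q : ℕ}
    (hp : p.Prime) (hq : q.Prime) (hp5 : p % 8 = 5) (hq3 : q % 8 = 3) :
    haveI := isElliptic_congruentNumberCurve (n := 2 * (p * q))
      (Nat.mul_ne_zero two_ne_zero (Nat.mul_ne_zero hp.ne_zero hq.ne_zero))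
    (congruentNumberCurve (2 * (p * q))).mordellWeilRank = 1 ∧
      Nat.card ((congruentNumberCurve (2 * (p * q))).selmerGroup 2) = 8 ∧
      ((congruentNumberCurve (2 * (p * q))).sha ⊓
        AddSubgroup.torsionBy (congruentNumberCurve (2 * (p * q))).galH1 ((2 : ℕ) : ℤ) :
          AddSubgroup (congruentNumberCurve (2 * (p * q))).galH1) = ⊥ ∧
      AddCommGroup.primaryComponent (congruentNumberCurve (2 * (p * q))).sha 2 = ⊥ ∧
      IsCongruentNumber (2 * (p * q)) := by
  have hq4 : q % 4 = 3 := by omega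
  have hrank := mordellWeilRank_eq_one_three_mod_eight_of_system hSys hp hq hp5 hq3
  refine ⟨hrank, card_selmerGroup_two_eq_eight_two_mul_five_mul hp hq hp5 hq4,
    (mordellWeilRank_eq_one_iff_sha_inf_torsionBy_two_eq_bot hp hq hp5 hq4).mp hrank,
    primaryComponent_sha_two_eq_bot_three_mod_eight_of_system hSys hp hq hp5 hq3,
    isCongruentNumber_three_mod_eight_of_system hSys hp hq hp5 hq3⟩

end Summit.BirchSwinnertonDyer.Rank1Residual.P2

end
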